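/-
Copyright (c) 2026 the pub-hodgecm-mathlib formalisation cell (harness21).  Prover seat hodgecm-mathlib-K2E4-p14 (g9), Track B ∕ K2-LIT, h413 = `stmt-HodgeConjecture-24833`,
line `K2_E1_TraceFormulaBeta`, campaign «EIS-R7-BL-SPH-3» — THE MAASS–SELBERG LETTERS ON THE REAL AXIS, FILE 3 (dealer K2E1-plan (g7) (200)∕(216)): the two visible letters
(MS-P) and (MS-2) of ★ `sphericalEisenstein_continuation_cm_three_of_road` (K2E4-p14 (g8), p859972) PAID in the road's own currency, at EVERY point `z₀` with `1 < Re z₀`.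
-/
import Summits.HodgeConjecture.HodgeConjecture.Theorems.K2E1MaassSelbergDiagonalRealAxisCMThree      -- ★ p860128 (this seat) FILE 1: the real-axis analysis of the diagonal four-term
import Summits.HodgeConjecture.HodgeConjecture.Theorems.K2E1MaassSelbergDiagonalLowerCMThree         -- ★ p860150 (this seat) FILE 2: lower-half-plane identity, reflection principle; brings ★ p859921
import Summits.HodgeConjecture.HodgeConjecture.Theorems.K2E1SphericalEisensteinPoleExclusionCMThree   -- ★ p859741 (K2E1-p11): `countable_ball_diff_of_codiscrete`; brings ★ `isPreconnected_convex_diff_of_countable`, `countable_of_codiscrete`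
import Summits.HodgeConjecture.HodgeConjecture.Theorems.K2E1BLRemovablePolesU                          -- ★ p859366 (K2E4-p10): `exists_analyticAt_eventuallyEq_of_differentiableAt_of_eventually_norm_le`
import HarnessLib

/-!
# K2·E1 — `K2E1SphericalEisensteinL2BoundCMThree`: (MS-P) AT EVERY `z₀ ≠ 2` WITH `1 < Re z₀` AND (MS-2) AT `z₀ = 2` for a road family of `U(2,1)∕CM` — the Maass–Selberg letters
# of ★ `sphericalEisenstein_continuation_cm_three_of_road`, PAID

Track B ∕ K2-LIT, crux h413 = `stmt-HodgeConjecture-24833`, route of record `HCCMUnconditional`; cell `hodgecm-mathlib`, squad K2, ENGINE E1, campaign EIS-R7-BL-SPH-3.  THEOREMS ONLY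
(no `def`, no `instance`, no notation, no named-fact hypothesis, no `sorry`); lane `--supports stmt-HodgeConjecture-24833 --as helper` (count-neutral).  Closes no socket.

WHAT.  In the currency of one ball of the road (★ p859972: `U` open and co-discrete in `ball 0 R`, `P` closed and co-discrete, the continued family `Ec` with the Godement agreement
`Ec z = E(φ₀H^z)` on `{2 < Re}`, ONE truncated `L²` family `Fam` at one level `T₀ ≥ 1`, holomorphic on `U ∖ P` with `Fam z = [Λ^{T₀} Ec z]` a.e.) plus the structural measures
(`ν 𝓕 = 1`, the covering weight, the compact ∕ idelic brackets) and the (L3)₃ scalar letters (`c̃` holomorphic on `{1 < Re} ∖ {2}` with the tube formula; for (MS-2) also the residue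
letter `(z − 2)c̃ → r`): **(MS-P)** `∃ C, ∀ᶠ z in 𝓝[≠] z₀, ‖Fam z‖ ≤ C` at EVERY `z₀ ∈ ball 0 R` with `1 < Re z₀`, `z₀ ≠ 2` — real or not, in `P` or not; **(MS-2)**
`∃ C, ∀ᶠ z in 𝓝[≠] 2, ‖(z − 2) • Fam z‖ ≤ C`.
PROOF.  §1: the quarter-plane ball domains `D± = ({1 < Re, ±Im > 0} ∩ ball 0 R ∩ U) ∖ P` with sub-tube boxes (convex open minus countable ⇒ preconnected; boxes non-empty by
density), the diagonal identities `‖Fam z‖² = R(z, z; c̃)` on `D⁺` (★ `normSq_family_eq_fourTerm_on'`) and `‖Fam ū‖² = R(u, u; c̃♯)` for `ū ∈ D⁻` (★ FILE 2, `c̃♯ = conj ∘ c̃ ∘ conj`), and the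
reflection principle `Im c̃(x) = 0` on `(1, ∞) ∖ {2}` (★ FILE 2; on the tube `c̃` is an integral of positive reals).  §2: FILE 1's bounds for `R` near `z₀` (scalar `c̃`) and near `z̄₀`
(scalar `c̃♯`) bound `‖Fam z‖` for non-real `z` near `z₀`; real points by continuity of `Fam` on `U ∖ P` (★ FILE 1 §4).  (MS-2): the same with FILE 1's `|z − 2|²`-weighted bound.
* §1 `exists_boxes_of_countable`, `im_scalar_eq_zero`, `exists_diag_identities_of_road`.
* §2 HEADS **`msP_of_road`** ((MS-P) everywhere off `2`), **`ms2_of_road`** ((MS-2)).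
HONEST LABEL: HC_CM is proved only modulo the 7 printed citations (2 remaining named inputs: hLiu418 = `stmt-HodgeConjecture-24832`, h413 = `stmt-HodgeConjecture-24833`) until rung 0
closes; this file asserts no named fact and closes no socket; count-neutral; unconditional (binder form).  FILE 4 (`K2E1SphericalEisensteinContinuationCMThree`) is the letter-free capstone₃.

## References
* [MoeglinWaldspurger1995] C. Mœglin, J.-L. Waldspurger, *Spectral decomposition and Eisenstein series* (1995), IV.1.9–IV.1.11, IV.2.3, IV.3.12 (a).
* [Arthur1980TraceFormulaII] J. Arthur, *A trace formula for reductive groups II*, Compositio Math. 40 (1980), §4.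
* [BernsteinLapid2019] J. Bernstein, E. Lapid, *On the meromorphic continuation of Eisenstein series*, J. AMS 37 (2024), Thm 2.3, §4.
-/

set_option autoImplicit false
-- the mandated namespace repeats `HodgeConjecture.HodgeConjecture`, as in every `Theorems/*.lean` of this sub-problem
set_option linter.dupNamespace false

noncomputable section

open MeasureTheory MeasureTheory.Measure Set NumberField IsDedekindDomain Filter Topology Metric
open scoped NNReal ENNReal ComplexConjugate InnerProductSpace
open Literature.MeasureTheory.Group Literature.NumberTheory
open Literature.NumberTheory.Automorphic Literature.NumberTheory.Automorphic.UnitaryGroup AdelicGroupData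
open Literature.NumberTheory.EllipticCurves.ModularForms (conj_ofReal_cpow)
open Summit.HodgeConjecture.HodgeConjecture.Cruxes.H413.K2E1BorelEisensteinU
open Summit.HodgeConjecture.HodgeConjecture.Cruxes.H413.K2E1BLBorelSpacesU2Defs
open Summit.HodgeConjecture.HodgeConjecture.Cruxes.H413.K2E1MaassSelbergContinuedCMTwo (differentiableOn_conj_comp_conj)
open Summit.HodgeConjecture.HodgeConjecture.Cruxes.H413.K2E1MaassSelbergDiagonalFourTermCMThree (normSq_family_eq_fourTerm_on')
open Summit.HodgeConjecture.HodgeConjecture.Cruxes.H413.K2E1MaassSelbergDiagonalLowerCMThree (normSq_family_eq_fourTerm_lower_on' im_apply_ofReal_eq_zero)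
open Summit.HodgeConjecture.HodgeConjecture.Cruxes.H413.K2E1MaassSelbergDiagonalRealAxisCMThree (exists_norm_fourTerm_diag_le exists_normSq_mul_norm_fourTerm_diag_le_two eventually_norm_le_of_im_ne_zero)
open Summit.HodgeConjecture.HodgeConjecture.Cruxes.H413.K2E1ConvexDiffCountableConnected (isPreconnected_convex_diff_of_countable countable_of_codiscrete)
open Summit.HodgeConjecture.HodgeConjecture.Cruxes.H413.K2E1SphericalEisensteinPoleExclusionCMThree (countable_ball_diff_of_codiscrete)
open Summit.HodgeConjecture.HodgeConjecture.Cruxes.H413.K2E1BLRemovablePolesU (exists_analyticAt_eventuallyEq_of_differentiableAt_of_eventually_norm_le)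

namespace Summit.HodgeConjecture.HodgeConjecture.Cruxes.H413.K2E1SphericalEisensteinL2BoundCMThree

/-! ## §1 Domains with boxes; the reflection principle for the scalar; the two diagonal identities of a road family -/

/-- **A DOMAIN WITH SUB-TUBE BOXES**: for `C` open convex, `U` open, `P` closed with `(C ∖ U) ∪ P` countable, and two points `w₁, w₂ ∈ C` with `2 < Re w₂ < Re w₁`, the set
`D = (C ∩ U) ∖ P` is open and preconnected (★ `isPreconnected_convex_diff_of_countable`) and carries open non-empty boxes `O₁, O₂′ ⊆ D` with `2 < Re z′ < Re z` on `O₁ × O₂′`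
(small balls around `w₁, w₂`; non-empty by density of the complement of a countable set). [cite: BernsteinLapid2019, §4 p. 10] -/
theorem exists_boxes_of_countable {C U P : Set ℂ} (hCo : IsOpen C) (hCc : Convex ℝ C) (hUo : IsOpen U) (hPc : IsClosed P) (hS : ((C \ U) ∪ P).Countable)
    {w₁ w₂ : ℂ} (hw₁ : w₁ ∈ C) (hw₂ : w₂ ∈ C) (h2 : 2 < w₂.re) (h12 : w₂.re < w₁.re) :
    IsOpen ((C ∩ U) \ P) ∧ IsPreconnected ((C ∩ U) \ P) ∧
      ∃ O₁ O₂' : Set ℂ, IsOpen O₁ ∧ O₁.Nonempty ∧ O₁ ⊆ (C ∩ U) \ P ∧ IsOpen O₂' ∧ O₂'.Nonempty ∧ O₂' ⊆ (C ∩ U) \ P ∧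
        ∀ z ∈ O₁, ∀ z' ∈ O₂', 2 < z'.re ∧ z'.re < z.re := by
  have hDS : (C ∩ U) \ P = C \ ((C \ U) ∪ P) := Set.ext fun z =>
    ⟨fun ⟨⟨hC, hU⟩, hP⟩ => ⟨hC, fun h => h.elim (fun h' => h'.2 hU) hP⟩, fun ⟨hC, hn⟩ => ⟨⟨hC, by_contra fun hU => hn (Or.inl ⟨hC, hU⟩)⟩, fun hP => hn (Or.inr hP)⟩⟩
  have hDo : IsOpen ((C ∩ U) \ P) := (hCo.inter hUo).sdiff hPc
  refine ⟨hDo, by rw [hDS]; exact isPreconnected_convex_diff_of_countable Literature.Topology.Euclidean.one_lt_rank_real_complex hCc hCo hS, ?_⟩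
  obtain ⟨ε₁, hε₁, hε₁C⟩ := Metric.isOpen_iff.1 hCo w₁ hw₁
  obtain ⟨ε₂, hε₂, hε₂C⟩ := Metric.isOpen_iff.1 hCo w₂ hw₂
  set ε : ℝ := min (min ε₁ ε₂) (min (w₂.re - 2) ((w₁.re - w₂.re) / 2)) with hεdef
  have hε : 0 < ε := lt_min (lt_min hε₁ hε₂) (lt_min (by linarith) (by linarith))
  have hε1 : ε ≤ ε₁ := (min_le_left _ _).trans (min_le_left _ _)
  have hε2 : ε ≤ ε₂ := (min_le_left _ _).trans (min_le_right _ _)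
  have hε3 : ε ≤ w₂.re - 2 := (min_le_right _ _).trans (min_le_left _ _)
  have hε4 : ε ≤ (w₁.re - w₂.re) / 2 := (min_le_right _ _).trans (min_le_right _ _)
  have hdense : Dense ((C \ U) ∪ P)ᶜ := hS.dense_compl ℝ
  have hne : ∀ w : ℂ, Metric.ball w ε ⊆ C → (((C ∩ U) \ P) ∩ Metric.ball w ε).Nonempty := fun w hwC => by
    obtain ⟨z, hzB, hzS⟩ := hdense.inter_open_nonempty (Metric.ball w ε) Metric.isOpen_ball ⟨w, Metric.mem_ball_self hε⟩
    refine ⟨z, ?_, hzB⟩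
    rw [hDS]
    exact ⟨hwC hzB, hzS⟩
  have hre : ∀ {z w : ℂ}, z ∈ Metric.ball w ε → |z.re - w.re| < ε := fun {z w} hz =>
    lt_of_le_of_lt (by simpa only [Complex.sub_re] using Complex.abs_re_le_norm (z - w)) (by rwa [Metric.mem_ball, dist_eq_norm] at hz)
  refine ⟨((C ∩ U) \ P) ∩ Metric.ball w₁ ε, ((C ∩ U) \ P) ∩ Metric.ball w₂ ε, hDo.inter Metric.isOpen_ball, hne w₁ ((Metric.ball_subset_ball hε1).trans hε₁C),
    Set.inter_subset_left, hDo.inter Metric.isOpen_ball, hne w₂ ((Metric.ball_subset_ball hε2).trans hε₂C), Set.inter_subset_left, fun z hz z' hz' => ?_⟩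
  have h1 := abs_lt.1 (hre hz.2)
  have h2' := abs_lt.1 (hre hz'.2)
  constructor <;> linarith [h1.1, h2'.1, h2'.2]

section Family

variable (L : Type) [Field L] [NumberField L] [IsCMField L]
variable [MeasurableSpace (quasiSplit (↥(maximalRealSubfield L)) L (IsCMField.complexConj L) 3).Adelic] [BorelSpace (quasiSplit (↥(maximalRealSubfield L)) L (IsCMField.complexConj L) 3).Adelic]
variable [MeasurableSpace (AdeleRing (𝓞 L) L)ˣ] [BorelSpace (AdeleRing (𝓞 L) L)ˣ]

omit [BorelSpace (quasiSplit (↥(maximalRealSubfield L)) L (IsCMField.complexConj L) 3).Adelic] [MeasurableSpace (AdeleRing (𝓞 L) L)ˣ] [BorelSpace (AdeleRing (𝓞 L) L)ˣ] in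
/-- **THE REFLECTION PRINCIPLE FOR THE (L3)₃ SCALAR**: a `c̃` holomorphic on `{1 < Re} ∖ {2}` with the tube formula `c̃(z) = ∫ H(ι(w₀)v)^z dν` on `{2 < Re}` — an integral of
POSITIVE REALS, so `c̃(z̄) = conj c̃(z)` there — is REAL at every real `x > 1`, `x ≠ 2` (★ FILE 2 `im_apply_ofReal_eq_zero` on the conj-symmetric preconnected `{1 < Re} ∖ {2}`).
[cite: MoeglinWaldspurger1995, IV.1.11] -/
theorem im_scalar_eq_zero (ν : Measure ↥(adelicUnipotent (↥(maximalRealSubfield L)) L (IsCMField.complexConj L) 3))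
    {c : ℂ → ℂ} (hchol : DifferentiableOn ℂ c ({z : ℂ | 1 < z.re} \ {2})) (hceq : ∀ z : ℂ, 2 < z.re → c z = (∫ v : ↥(adelicUnipotent (↥(maximalRealSubfield L)) L (IsCMField.complexConj L) 3), (((borelHeight ((quasiSplit (↥(maximalRealSubfield L)) L (IsCMField.complexConj L) 3).toAdelic (weylLongU ((IsCMField.complexConj L : L ≃ₐ[↥(maximalRealSubfield L)] L) : L →+* L) (rfl : (StdForm.antidiagonal 3).over L = (StdForm.antidiagonal 3).over L)) * (v : (quasiSplit (↥(maximalRealSubfield L)) L (IsCMField.complexConj L) 3).Adelic))) : ℝ) : ℂ) ^ z ∂ν))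
    {x : ℝ} (hx : 1 < x) (hx2 : x ≠ 2) : (c (x : ℂ)).im = 0 := by
  have hHo : IsOpen {z : ℂ | 1 < z.re} := isOpen_lt continuous_const Complex.continuous_re
  have hVo : IsOpen ({z : ℂ | 1 < z.re} \ {2}) := hHo.sdiff isClosed_singleton
  have hVc : IsPreconnected ({z : ℂ | 1 < z.re} \ {2}) :=
    isPreconnected_convex_diff_of_countable Literature.Topology.Euclidean.one_lt_rank_real_complex (convex_halfSpace_re_gt 1) hHo (Set.countable_singleton 2)
  have hVsymm : ∀ z ∈ {z : ℂ | 1 < z.re} \ {2}, conj z ∈ {z : ℂ | 1 < z.re} \ {2} := fun z hz =>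
    ⟨by simpa only [Set.mem_setOf_eq, Complex.conj_re] using hz.1, fun h => hz.2 (by
      rw [Set.mem_singleton_iff] at h ⊢
      have h' := congrArg conj h
      rwa [Complex.conj_conj, Complex.conj_ofNat] at h')⟩
  have h3 : (3 : ℂ) ∈ {z : ℂ | 1 < z.re} \ {2} := ⟨by norm_num, by norm_num⟩
  have hsymm : ∀ᶠ z in 𝓝 (3 : ℂ), c (conj z) = conj (c z) := by
    filter_upwards [(isOpen_lt continuous_const Complex.continuous_re).mem_nhds (show (2 : ℝ) < (3 : ℂ).re by norm_num)] with z hz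
    have hz' : 2 < (conj z).re := by rwa [Complex.conj_re]
    rw [hceq _ hz', hceq z hz, ← integral_conj]
    refine integral_congr_ae (Eventually.of_forall fun v => ?_)
    show _ = conj _
    rw [conj_ofReal_cpow (NNReal.coe_nonneg _)]
  exact im_apply_ofReal_eq_zero hVo hVc hVsymm hchol h3 hsymm ⟨by simpa only [Set.mem_setOf_eq, Complex.ofReal_re] using hx, fun h => hx2 (by
    rw [Set.mem_singleton_iff] at h
    exact_mod_cast h)⟩

/-- **THE TWO DIAGONAL IDENTITIES OF A ROAD FAMILY** on one ball: on the upper quarter-plane ball domain `‖Fam z‖² = R(z, z; c̃ z)` (★ `normSq_family_eq_fourTerm_on'`), and for `ū`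
in the lower one `‖Fam ū‖² = R(u, u; conj (c̃ ū))` (★ FILE 2 `normSq_family_eq_fourTerm_lower_on'`); the domains and boxes are §1's (`R ≥ 3` puts the witness points
`2.7 ± 0.05i`, `2.25 ± 0.05i` in the ball). [cite: MoeglinWaldspurger1995, IV.2.3, IV.3.12 (a)] [cite: BernsteinLapid2019, §4] -/
theorem exists_diag_identities_of_road
    (μ : Measure (quasiSplit (↥(maximalRealSubfield L)) L (IsCMField.complexConj L) 3).automorphicQuotient) [(quasiSplit (↥(maximalRealSubfield L)) L (IsCMField.complexConj L) 3).IsAutomorphicMeasure μ]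
    (νG : Measure (quasiSplit (↥(maximalRealSubfield L)) L (IsCMField.complexConj L) 3).Adelic) [νG.IsHaarMeasure] [νG.IsInvInvariant]
    (μK : Measure ((standardMaximalCompactGL 3 L).comap (adelicVal (↥(maximalRealSubfield L)) L (IsCMField.complexConj L) 3 ((StdForm.antidiagonal 3).over L)) : Subgroup (quasiSplit (↥(maximalRealSubfield L)) L (IsCMField.complexConj L) 3).Adelic))
    [μK.IsHaarMeasure]
    (νI : Measure (AdeleRing (𝓞 L) L)ˣ) [νI.IsHaarMeasure]
    {𝓕I : Set (AdeleRing (𝓞 L) L)ˣ} (h𝓕I : IsIdeleClassDomain L 𝓕I)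
    (ν : Measure ↥(adelicUnipotent (↥(maximalRealSubfield L)) L (IsCMField.complexConj L) 3)) [ν.IsHaarMeasure]
    {𝓕 : Set ↥(adelicUnipotent (↥(maximalRealSubfield L)) L (IsCMField.complexConj L) 3)} (h𝓕N : IsFundamentalDomain ↥(rationalUnipotent (↥(maximalRealSubfield L)) L (IsCMField.complexConj L) 3) 𝓕 ν) (h𝓕1 : ν 𝓕 = 1)
    (h𝓕c : IsCompact (closure 𝓕))
    {β : (quasiSplit (↥(maximalRealSubfield L)) L (IsCMField.complexConj L) 3).Adelic → ℝ≥0∞} (hβ : IsCoveringWeight ((arithmeticBorel (↥(maximalRealSubfield L)) L (IsCMField.complexConj L) 3).map (quasiSplit (↥(maximalRealSubfield L)) L (IsCMField.complexConj L) 3).arithmeticSubgroup.subtype) β)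
    {φ₀ : ℂ}
    -- the (L3)₃ scalar: holomorphic on `{1 < Re} ∖ {2}` with the (normalised) tube formula
    {c : ℂ → ℂ} (hchol : DifferentiableOn ℂ c ({z : ℂ | 1 < z.re} \ {2})) (hceq : ∀ z : ℂ, 2 < z.re → c z = (∫ v : ↥(adelicUnipotent (↥(maximalRealSubfield L)) L (IsCMField.complexConj L) 3), (((borelHeight ((quasiSplit (↥(maximalRealSubfield L)) L (IsCMField.complexConj L) 3).toAdelic (weylLongU ((IsCMField.complexConj L : L ≃ₐ[↥(maximalRealSubfield L)] L) : L →+* L) (rfl : (StdForm.antidiagonal 3).over L = (StdForm.antidiagonal 3).over L)) * (v : (quasiSplit (↥(maximalRealSubfield L)) L (IsCMField.complexConj L) 3).Adelic))) : ℝ) : ℂ) ^ z ∂ν))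
    -- one ball of the road: holomorphy set `U`, pole set `P`, continued family `Ec`, the truncated `L²` family at one level
    {R : ℝ} (hR : 3 ≤ R) {U P : Set ℂ} (hUo : IsOpen U) (hUcd : ∀ z₀ ∈ Metric.ball (0 : ℂ) R, ∀ᶠ s in 𝓝[≠] z₀, s ∈ U)
    (hPc : IsClosed P) (hPcd : ∀ z₀ : ℂ, ∀ᶠ s in 𝓝[≠] z₀, s ∉ P)
    (Ec : ℂ → (quasiSplit (↥(maximalRealSubfield L)) L (IsCMField.complexConj L) 3).Adelic → ℂ) (hEcE : ∀ z : ℂ, 2 < z.re → Ec z = eisensteinSeriesU (flatSectionU (fun _ : (quasiSplit (↥(maximalRealSubfield L)) L (IsCMField.complexConj L) 3).Adelic => φ₀) z))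
    {T₀ : ℝ≥0} (hT₀ : 1 ≤ T₀) (Fam : ℂ → Lp ℂ 2 μ) (hFd : DifferentiableOn ℂ Fam (U \ P))
    (hFam : ∀ z ∈ U \ P, ((Fam z : Lp ℂ 2 μ) : (quasiSplit (↥(maximalRealSubfield L)) L (IsCMField.complexConj L) 3).automorphicQuotient → ℂ) =ᵐ[μ] (quasiSplit (↥(maximalRealSubfield L)) L (IsCMField.complexConj L) 3).quotFun (truncation ν 𝓕 T₀ (Ec z))) :
    ∃ cμ K cμ' K' : ℝ,
      (∀ z : ℂ, z ∈ Metric.ball (0 : ℂ) R → 1 < z.re → 0 < z.im → z ∈ U → z ∉ P → (((‖Fam z‖ ^ 2 : ℝ)) : ℂ) =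
      ((cμ : ℝ) : ℂ) * (((K : ℝ) : ℂ) *
        ((((T₀ : ℝ) : ℂ) ^ (z + conj z - 2) / (z + conj z - 2)) * ((((∫ x in {x : (AdeleRing (𝓞 L) L)ˣ | (IdeleClassGroup.ideleNorm L x : ℝ) ≤ 1} ∩ 𝓕I, (IdeleClassGroup.ideleNorm L x : ℝ) ∂νI) : ℝ) : ℂ) * (((μK.real Set.univ : ℝ) : ℂ) * (φ₀ * conj φ₀)))
          + (((T₀ : ℝ) : ℂ) ^ (z - conj z) / (z - conj z)) * ((((∫ x in {x : (AdeleRing (𝓞 L) L)ˣ | (IdeleClassGroup.ideleNorm L x : ℝ) ≤ 1} ∩ 𝓕I, (IdeleClassGroup.ideleNorm L x : ℝ) ∂νI) : ℝ) : ℂ) * (((μK.real Set.univ : ℝ) : ℂ) * (φ₀ * conj (c z * φ₀))))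
          - (((T₀ : ℝ) : ℂ) ^ (-(z - conj z)) / (z - conj z)) * ((((∫ x in {x : (AdeleRing (𝓞 L) L)ˣ | (IdeleClassGroup.ideleNorm L x : ℝ) ≤ 1} ∩ 𝓕I, (IdeleClassGroup.ideleNorm L x : ℝ) ∂νI) : ℝ) : ℂ) * (((μK.real Set.univ : ℝ) : ℂ) * (c z * φ₀ * conj φ₀)))
          - (((T₀ : ℝ) : ℂ) ^ (-(z + conj z - 2)) / (z + conj z - 2)) * ((((∫ x in {x : (AdeleRing (𝓞 L) L)ˣ | (IdeleClassGroup.ideleNorm L x : ℝ) ≤ 1} ∩ 𝓕I, (IdeleClassGroup.ideleNorm L x : ℝ) ∂νI) : ℝ) : ℂ) * (((μK.real Set.univ : ℝ) : ℂ) * (c z * φ₀ * conj (c z * φ₀))))))) ∧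
      (∀ u : ℂ, conj u ∈ Metric.ball (0 : ℂ) R → 1 < u.re → 0 < u.im → conj u ∈ U → conj u ∉ P → (((‖Fam (conj u)‖ ^ 2 : ℝ)) : ℂ) =
      ((cμ' : ℝ) : ℂ) * (((K' : ℝ) : ℂ) *
        ((((T₀ : ℝ) : ℂ) ^ (u + conj u - 2) / (u + conj u - 2)) * ((((∫ x in {x : (AdeleRing (𝓞 L) L)ˣ | (IdeleClassGroup.ideleNorm L x : ℝ) ≤ 1} ∩ 𝓕I, (IdeleClassGroup.ideleNorm L x : ℝ) ∂νI) : ℝ) : ℂ) * (((μK.real Set.univ : ℝ) : ℂ) * (φ₀ * conj φ₀)))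
          + (((T₀ : ℝ) : ℂ) ^ (u - conj u) / (u - conj u)) * ((((∫ x in {x : (AdeleRing (𝓞 L) L)ˣ | (IdeleClassGroup.ideleNorm L x : ℝ) ≤ 1} ∩ 𝓕I, (IdeleClassGroup.ideleNorm L x : ℝ) ∂νI) : ℝ) : ℂ) * (((μK.real Set.univ : ℝ) : ℂ) * (φ₀ * conj (conj (c (conj u)) * φ₀))))
          - (((T₀ : ℝ) : ℂ) ^ (-(u - conj u)) / (u - conj u)) * ((((∫ x in {x : (AdeleRing (𝓞 L) L)ˣ | (IdeleClassGroup.ideleNorm L x : ℝ) ≤ 1} ∩ 𝓕I, (IdeleClassGroup.ideleNorm L x : ℝ) ∂νI) : ℝ) : ℂ) * (((μK.real Set.univ : ℝ) : ℂ) * (conj (c (conj u)) * φ₀ * conj φ₀)))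
          - (((T₀ : ℝ) : ℂ) ^ (-(u + conj u - 2)) / (u + conj u - 2)) * ((((∫ x in {x : (AdeleRing (𝓞 L) L)ˣ | (IdeleClassGroup.ideleNorm L x : ℝ) ≤ 1} ∩ 𝓕I, (IdeleClassGroup.ideleNorm L x : ℝ) ∂νI) : ℝ) : ℂ) * (((μK.real Set.univ : ℝ) : ℂ) * (conj (c (conj u)) * φ₀ * conj (conj (c (conj u)) * φ₀))))))) := by
  have hreo : IsOpen {z : ℂ | 1 < z.re} := isOpen_lt continuous_const Complex.continuous_re
  have hQo : IsOpen {z : ℂ | 1 < z.re ∧ 0 < z.im} := hreo.inter (isOpen_lt continuous_const Complex.continuous_im)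
  have hQo' : IsOpen {z : ℂ | 1 < z.re ∧ z.im < 0} := hreo.inter (isOpen_lt Complex.continuous_im continuous_const)
  have hQc : Convex ℝ ({z : ℂ | 1 < z.re ∧ 0 < z.im} ∩ Metric.ball (0 : ℂ) R) := ((convex_halfSpace_re_gt 1).inter (convex_halfSpace_im_gt 0)).inter (convex_ball (0 : ℂ) R)
  have hQc' : Convex ℝ ({z : ℂ | 1 < z.re ∧ z.im < 0} ∩ Metric.ball (0 : ℂ) R) := ((convex_halfSpace_re_gt 1).inter (convex_halfSpace_im_lt 0)).inter (convex_ball (0 : ℂ) R)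
  have hcnt : ∀ Q : Set ℂ, (((Q ∩ Metric.ball (0 : ℂ) R) \ U) ∪ P).Countable := fun Q =>
    ((countable_ball_diff_of_codiscrete hUcd).mono fun z (hz : z ∈ (Q ∩ Metric.ball (0 : ℂ) R) \ U) => (⟨hz.1.2, hz.2⟩ : z ∈ Metric.ball (0 : ℂ) R \ U)).union
      (countable_of_codiscrete hPcd)
  have hball : ∀ w : ℂ, |w.re| + |w.im| < 3 → w ∈ Metric.ball (0 : ℂ) R := fun w hw =>
    mem_ball_zero_iff.2 (lt_of_le_of_lt (Complex.norm_le_abs_re_add_abs_im w) (by linarith))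
  have hw₁ : (⟨27 / 10, 1 / 20⟩ : ℂ) ∈ {z : ℂ | 1 < z.re ∧ 0 < z.im} ∩ Metric.ball (0 : ℂ) R := ⟨⟨by norm_num, by norm_num⟩, hball _ (by norm_num [abs_of_pos])⟩
  have hw₂ : (⟨9 / 4, 1 / 20⟩ : ℂ) ∈ {z : ℂ | 1 < z.re ∧ 0 < z.im} ∩ Metric.ball (0 : ℂ) R := ⟨⟨by norm_num, by norm_num⟩, hball _ (by norm_num [abs_of_pos])⟩
  have hw₁' : (⟨27 / 10, -(1 / 20)⟩ : ℂ) ∈ {z : ℂ | 1 < z.re ∧ z.im < 0} ∩ Metric.ball (0 : ℂ) R := ⟨⟨by norm_num, by norm_num⟩, hball _ (by norm_num [abs_of_pos, abs_of_neg])⟩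
  have hw₂' : (⟨9 / 4, -(1 / 20)⟩ : ℂ) ∈ {z : ℂ | 1 < z.re ∧ z.im < 0} ∩ Metric.ball (0 : ℂ) R := ⟨⟨by norm_num, by norm_num⟩, hball _ (by norm_num [abs_of_pos, abs_of_neg])⟩
  -- the scalar and the family on the two domains
  have hcD : ∀ Q : Set ℂ, Q ⊆ {z : ℂ | z.im ≠ 0} → DifferentiableOn ℂ c (((({z : ℂ | 1 < z.re} ∩ Q) ∩ Metric.ball (0 : ℂ) R) ∩ U) \ P) := fun Q hQ =>
    hchol.mono fun z hz => ⟨hz.1.1.1.1, fun h2 => hQ hz.1.1.1.2 (by rw [Set.mem_singleton_iff] at h2; rw [h2]; norm_num)⟩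
  have hFtube : ∀ z ∈ U \ P, 2 < z.re → ((Fam z : Lp ℂ 2 μ) : (quasiSplit (↥(maximalRealSubfield L)) L (IsCMField.complexConj L) 3).automorphicQuotient → ℂ) =ᵐ[μ] (quasiSplit (↥(maximalRealSubfield L)) L (IsCMField.complexConj L) 3).quotFun (truncation ν 𝓕 T₀ (eisensteinSeriesU (flatSectionU (fun _ : (quasiSplit (↥(maximalRealSubfield L)) L (IsCMField.complexConj L) 3).Adelic => φ₀) z))) :=
    fun z hz hz2 => by rw [← hEcE z hz2]; exact hFam z hz
  -- upper
  have hset : ∀ Q : Set ℂ, {z : ℂ | 1 < z.re ∧ z ∈ Q} = {z : ℂ | 1 < z.re} ∩ Q := fun Q => rfl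
  obtain ⟨hDo, hDc, O₁, O₂', hO₁o, hO₁ne, hO₁D, hO₂o, hO₂ne, hO₂D, hsep⟩ :=
    exists_boxes_of_countable (hQo.inter Metric.isOpen_ball) hQc hUo hPc (hcnt _) hw₁ hw₂ (by norm_num) (by norm_num)
  have hsubUP : (({z : ℂ | 1 < z.re ∧ 0 < z.im} ∩ Metric.ball (0 : ℂ) R) ∩ U) \ P ⊆ U \ P := fun z hz => ⟨hz.1.2, hz.2⟩
  obtain ⟨cμ, K, -, -, hdiag⟩ := normSq_family_eq_fourTerm_on' L hDo hDc (fun z hz => hz.1.1.1) hO₁o hO₁ne hO₁D hO₂o hO₂ne hO₂D hsep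
    μ νG μK νI h𝓕I ν h𝓕N h𝓕1 h𝓕c hT₀ hβ
    (hchol.mono fun z hz => ⟨hz.1.1.1.1, fun h2 => by
      have him := hz.1.1.1.2
      rw [Set.mem_singleton_iff] at h2
      rw [h2] at him
      norm_num at him⟩) hceq Fam (hFd.mono hsubUP) (fun z hz hz2 => hFtube z (hsubUP hz) hz2)
  -- lower
  obtain ⟨hDo', hDc', O₃, O₄', hO₃o, hO₃ne, hO₃D, hO₄o, hO₄ne, hO₄D, hsep'⟩ :=
    exists_boxes_of_countable (hQo'.inter Metric.isOpen_ball) hQc' hUo hPc (hcnt _) hw₁' hw₂' (by norm_num) (by norm_num)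
  have hsubUP' : (({z : ℂ | 1 < z.re ∧ z.im < 0} ∩ Metric.ball (0 : ℂ) R) ∩ U) \ P ⊆ U \ P := fun z hz => ⟨hz.1.2, hz.2⟩
  obtain ⟨cμ', K', -, -, hdiag'⟩ := normSq_family_eq_fourTerm_lower_on' L hDo' hDc' (fun z hz => hz.1.1.1) hO₃o hO₃ne hO₃D hO₄o hO₄ne hO₄D hsep'
    μ νG μK νI h𝓕I ν h𝓕N h𝓕1 h𝓕c hT₀ hβ
    (hchol.mono fun z hz => ⟨hz.1.1.1.1, fun h2 => by
      have him := hz.1.1.1.2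
      rw [Set.mem_singleton_iff] at h2
      rw [h2] at him
      norm_num at him⟩) hceq Fam (hFd.mono hsubUP') (fun z hz hz2 => hFtube z (hsubUP' hz) hz2)
  exact ⟨cμ, K, cμ', K', fun z hzb hz1 hzi hzU hzP => hdiag z ⟨⟨⟨⟨hz1, hzi⟩, hzb⟩, hzU⟩, hzP⟩,
    fun u hub hu1 hui huU huP => hdiag' u ⟨⟨⟨⟨by rwa [Complex.conj_re], by rw [Complex.conj_im]; linarith⟩, hub⟩, huU⟩, huP⟩⟩

/-! ## §2 HEADS: (MS-P) at every `z₀ ≠ 2` with `1 < Re z₀`, and (MS-2) -/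

/-- **(MS-P) OF ★ `sphericalEisenstein_continuation_cm_three_of_road`, PAID AT EVERY `z₀ ∈ ball 0 R` WITH `1 < Re z₀`, `z₀ ≠ 2`** (real or not, in `P` or not): the truncated `L²`
family of the road is bounded near `z₀`.  Upper half-disc: `‖Fam z‖² = R(z, z; c̃)` and FILE 1's bound (scalar `c̃`, analytic at `z₀`, real on the real trace); lower half-disc:
`‖Fam z‖² = R(z̄, z̄; c̃♯)` and FILE 1's bound at `z̄₀` (scalar `c̃♯ = conj ∘ c̃ ∘ conj`); real points: continuity of `Fam` on `U ∖ P` (★ FILE 1 §4).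
[cite: MoeglinWaldspurger1995, IV.2.3, IV.3.12 (a)] [cite: Arthur1980TraceFormulaII, §4] [cite: BernsteinLapid2019, Thm 2.3, §4] -/
theorem msP_of_road
    (μ : Measure (quasiSplit (↥(maximalRealSubfield L)) L (IsCMField.complexConj L) 3).automorphicQuotient) [(quasiSplit (↥(maximalRealSubfield L)) L (IsCMField.complexConj L) 3).IsAutomorphicMeasure μ]
    (νG : Measure (quasiSplit (↥(maximalRealSubfield L)) L (IsCMField.complexConj L) 3).Adelic) [νG.IsHaarMeasure] [νG.IsInvInvariant]
    (μK : Measure ((standardMaximalCompactGL 3 L).comap (adelicVal (↥(maximalRealSubfield L)) L (IsCMField.complexConj L) 3 ((StdForm.antidiagonal 3).over L)) : Subgroup (quasiSplit (↥(maximalRealSubfield L)) L (IsCMField.complexConj L) 3).Adelic))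
    [μK.IsHaarMeasure]
    (νI : Measure (AdeleRing (𝓞 L) L)ˣ) [νI.IsHaarMeasure]
    {𝓕I : Set (AdeleRing (𝓞 L) L)ˣ} (h𝓕I : IsIdeleClassDomain L 𝓕I)
    (ν : Measure ↥(adelicUnipotent (↥(maximalRealSubfield L)) L (IsCMField.complexConj L) 3)) [ν.IsHaarMeasure]
    {𝓕 : Set ↥(adelicUnipotent (↥(maximalRealSubfield L)) L (IsCMField.complexConj L) 3)} (h𝓕N : IsFundamentalDomain ↥(rationalUnipotent (↥(maximalRealSubfield L)) L (IsCMField.complexConj L) 3) 𝓕 ν) (h𝓕1 : ν 𝓕 = 1)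
    (h𝓕c : IsCompact (closure 𝓕))
    {β : (quasiSplit (↥(maximalRealSubfield L)) L (IsCMField.complexConj L) 3).Adelic → ℝ≥0∞} (hβ : IsCoveringWeight ((arithmeticBorel (↥(maximalRealSubfield L)) L (IsCMField.complexConj L) 3).map (quasiSplit (↥(maximalRealSubfield L)) L (IsCMField.complexConj L) 3).arithmeticSubgroup.subtype) β)
    {φ₀ : ℂ}
    -- the (L3)₃ scalar: holomorphic on `{1 < Re} ∖ {2}` with the (normalised) tube formula
    {c : ℂ → ℂ} (hchol : DifferentiableOn ℂ c ({z : ℂ | 1 < z.re} \ {2})) (hceq : ∀ z : ℂ, 2 < z.re → c z = (∫ v : ↥(adelicUnipotent (↥(maximalRealSubfield L)) L (IsCMField.complexConj L) 3), (((borelHeight ((quasiSplit (↥(maximalRealSubfield L)) L (IsCMField.complexConj L) 3).toAdelic (weylLongU ((IsCMField.complexConj L : L ≃ₐ[↥(maximalRealSubfield L)] L) : L →+* L) (rfl : (StdForm.antidiagonal 3).over L = (StdForm.antidiagonal 3).over L)) * (v : (quasiSplit (↥(maximalRealSubfield L)) L (IsCMField.complexConj L) 3).Adelic))) : ℝ)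 : ℂ) ^ z ∂ν))
    -- one ball of the road: holomorphy set `U`, pole set `P`, continued family `Ec`, the truncated `L²` family at one level
    {R : ℝ} (hR : 3 ≤ R) {U P : Set ℂ} (hUo : IsOpen U) (hUcd : ∀ z₀ ∈ Metric.ball (0 : ℂ) R, ∀ᶠ s in 𝓝[≠] z₀, s ∈ U)
    (hPc : IsClosed P) (hPcd : ∀ z₀ : ℂ, ∀ᶠ s in 𝓝[≠] z₀, s ∉ P)
    (Ec : ℂ → (quasiSplit (↥(maximalRealSubfield L)) L (IsCMField.complexConj L) 3).Adelic → ℂ) (hEcE : ∀ z : ℂ, 2 < z.re → Ec z = eisensteinSeriesU (flatSectionU (fun _ : (quasiSplit (↥(maximalRealSubfield L)) L (IsCMField.complexConj L) 3).Adelic => φ₀) z))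
    {T₀ : ℝ≥0} (hT₀ : 1 ≤ T₀) (Fam : ℂ → Lp ℂ 2 μ) (hFd : DifferentiableOn ℂ Fam (U \ P))
    (hFam : ∀ z ∈ U \ P, ((Fam z : Lp ℂ 2 μ) : (quasiSplit (↥(maximalRealSubfield L)) L (IsCMField.complexConj L) 3).automorphicQuotient → ℂ) =ᵐ[μ] (quasiSplit (↥(maximalRealSubfield L)) L (IsCMField.complexConj L) 3).quotFun (truncation ν 𝓕 T₀ (Ec z)))
    {z₀ : ℂ} (hz₀b : z₀ ∈ Metric.ball (0 : ℂ) R) (hz₀ : 1 < z₀.re) (hz₀2 : z₀ ≠ 2) :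
    ∃ C : ℝ, ∀ᶠ z in 𝓝[≠] z₀, ‖Fam z‖ ≤ C := by
  obtain ⟨cμ, K, cμ', K', hdiag, hdiag'⟩ := exists_diag_identities_of_road L μ νG μK νI h𝓕I ν h𝓕N h𝓕1 h𝓕c hβ hchol hceq hR hUo hUcd hPc hPcd Ec hEcE hT₀ Fam hFd hFam
  set κI : ℝ := (∫ x in {x : (AdeleRing (𝓞 L) L)ˣ | (IdeleClassGroup.ideleNorm L x : ℝ) ≤ 1} ∩ 𝓕I, (IdeleClassGroup.ideleNorm L x : ℝ) ∂νI) with hκI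
  set mK : ℝ := μK.real Set.univ with hmK
  have hT₀pos : (0 : ℝ) < ((T₀ : ℝ≥0) : ℝ) := lt_of_lt_of_le one_pos (by exact_mod_cast hT₀)
  have hVo : IsOpen ({z : ℂ | 1 < z.re} \ {2}) := (isOpen_lt continuous_const Complex.continuous_re).sdiff isClosed_singleton
  have hVsymm : ∀ z ∈ {z : ℂ | 1 < z.re} \ {2}, conj z ∈ {z : ℂ | 1 < z.re} \ {2} := fun z hz =>
    ⟨by simpa only [Set.mem_setOf_eq, Complex.conj_re] using hz.1, fun h => hz.2 (by
      rw [Set.mem_singleton_iff] at h ⊢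
      have h' := congrArg conj h
      rwa [Complex.conj_conj, Complex.conj_ofNat] at h')⟩
  have hVset : {w : ℂ | conj w ∈ {z : ℂ | 1 < z.re} \ {2}} = {z : ℂ | 1 < z.re} \ {2} :=
    Set.ext fun w => ⟨fun hw => by simpa only [Complex.conj_conj] using hVsymm _ hw, fun hw => hVsymm w hw⟩
  have hcreal : ∀ x : ℝ, 1 < x → x ≠ 2 → (c (x : ℂ)).im = 0 := fun x hx hx2 => im_scalar_eq_zero L ν hchol hceq hx hx2
  -- the scalars `c̃` at `z₀` and `c̃♯` at `z̄₀`
  have hcan : AnalyticAt ℂ c z₀ := hchol.analyticOnNhd hVo z₀ ⟨hz₀, hz₀2⟩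
  have hc' : DifferentiableOn ℂ (fun u : ℂ => conj (c (conj u))) ({z : ℂ | 1 < z.re} \ {2}) := by
    have h := differentiableOn_conj_comp_conj hVo hchol
    rwa [hVset] at h
  have hcan' : AnalyticAt ℂ (fun u : ℂ => conj (c (conj u))) (conj z₀) := hc'.analyticOnNhd hVo _ (hVsymm z₀ ⟨hz₀, hz₀2⟩)
  have hreal : z₀.im = 0 → ∀ᶠ x : ℝ in 𝓝[≠] z₀.re, (c (x : ℂ)).im = 0 := fun h0 => by
    have hre2 : z₀.re ≠ 2 := fun h => hz₀2 (Complex.ext (by simp [h]) (by simp [h0]))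
    exact mem_nhdsWithin_of_mem_nhds (((lt_mem_nhds hz₀).and (isOpen_ne.mem_nhds hre2)).mono fun x hx => hcreal x hx.1 hx.2)
  have hreal' : (conj z₀).im = 0 → ∀ᶠ x : ℝ in 𝓝[≠] (conj z₀).re, ((fun u : ℂ => conj (c (conj u))) (x : ℂ)).im = 0 := fun h0 => by
    rw [Complex.conj_im, neg_eq_zero] at h0
    rw [Complex.conj_re]
    filter_upwards [hreal h0] with x hx
    simp only [Complex.conj_ofReal, Complex.conj_im, hx, neg_zero]
  -- FILE 1's bounds, above near `z₀` and (reflected) below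
  obtain ⟨C₁, hC₁⟩ := exists_norm_fourTerm_diag_le cμ K κI mK hT₀pos φ₀ hz₀ hcan hreal
  obtain ⟨C₂, hC₂⟩ := exists_norm_fourTerm_diag_le cμ' K' κI mK hT₀pos φ₀ (c := fun u : ℂ => conj (c (conj u))) (z₀ := conj z₀) (by rwa [Complex.conj_re]) hcan' hreal'
  have hC₂' := (Complex.continuous_conj.tendsto z₀).eventually hC₂
  -- near `z₀` one is in `U ∖ P`, in the ball, right of `Re = 1`
  have hmem : ∀ᶠ z in 𝓝[≠] z₀, z ∈ U \ P := by filter_upwards [hUcd z₀ hz₀b, hPcd z₀] with z hU hP using ⟨hU, hP⟩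
  have hnear : ∀ᶠ z in 𝓝[≠] z₀, 1 < z.re ∧ z ∈ Metric.ball (0 : ℂ) R :=
    mem_nhdsWithin_of_mem_nhds (Filter.inter_mem ((isOpen_lt continuous_const Complex.continuous_re).mem_nhds hz₀) (Metric.isOpen_ball.mem_nhds hz₀b))
  have key : ∀ᶠ z in 𝓝[≠] z₀, z.im ≠ 0 → ‖Fam z‖ ≤ max (Real.sqrt C₁) (Real.sqrt C₂) := by
    filter_upwards [hmem, hnear, mem_nhdsWithin_of_mem_nhds hC₁, mem_nhdsWithin_of_mem_nhds hC₂'] with z hzUP hz1b hz₁ hz₂ hzim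
    have hsq : ‖Fam z‖ ^ 2 = ‖(((‖Fam z‖ ^ 2 : ℝ)) : ℂ)‖ := by rw [Complex.norm_real, Real.norm_of_nonneg (sq_nonneg _)]
    have hroot : ∀ {C : ℝ}, ‖Fam z‖ ^ 2 ≤ C → ‖Fam z‖ ≤ Real.sqrt C := fun {C} h =>
      (Real.sqrt_sq (norm_nonneg _)).symm.trans_le (Real.sqrt_le_sqrt h)
    rcases lt_or_gt_of_ne hzim with hneg | hpos
    · have h1 := hdiag' (conj z) (by rw [Complex.conj_conj]; exact hz1b.2) (by rw [Complex.conj_re]; exact hz1b.1)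
        (by rw [Complex.conj_im]; linarith) (by rw [Complex.conj_conj]; exact hzUP.1) (by rw [Complex.conj_conj]; exact hzUP.2)
      have h2 : ‖(((‖Fam (conj (conj z))‖ ^ 2 : ℝ)) : ℂ)‖ ≤ C₂ := by
        rw [h1]
        exact hz₂ (by rw [Complex.conj_im]; exact neg_ne_zero.2 hzim)
      rw [Complex.conj_conj, ← hsq] at h2
      exact (hroot h2).trans (le_max_right _ _)
    · have h1 := hdiag z hz1b.2 hz1b.1 hpos hzUP.1 hzUP.2
      have h2 : ‖(((‖Fam z‖ ^ 2 : ℝ)) : ℂ)‖ ≤ C₁ := by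
        rw [h1]
        exact hz₁ hzim
      rw [← hsq] at h2
      exact (hroot h2).trans (le_max_left _ _)
  exact ⟨_, eventually_norm_le_of_im_ne_zero (hUo.sdiff hPc) hFd.continuousOn hmem key⟩

/-- **(MS-2) OF ★ `sphericalEisenstein_continuation_cm_three_of_road`, PAID**: with the residue letter `(z − 2)c̃(z) → r` of (L3)₃, `‖(z − 2) • Fam z‖` is bounded near `z₀ = 2` (punctured).
`d := (z − 2)c̃` is made analytic at `2` (★ removable brick), FILE 1's weighted bound is used above (scalars `c̃, d`) and, reflected, below (scalars `c̃♯, d♯`), and the real points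
follow by continuity of `z ↦ (z − 2) • Fam z` on `U ∖ P`. [cite: MoeglinWaldspurger1995, IV.1.11, IV.3.12 (a)] [cite: Arthur1980TraceFormulaII, §4] [cite: BernsteinLapid2019, §4] -/
theorem ms2_of_road
    (μ : Measure (quasiSplit (↥(maximalRealSubfield L)) L (IsCMField.complexConj L) 3).automorphicQuotient) [(quasiSplit (↥(maximalRealSubfield L)) L (IsCMField.complexConj L) 3).IsAutomorphicMeasure μ]
    (νG : Measure (quasiSplit (↥(maximalRealSubfield L)) L (IsCMField.complexConj L) 3).Adelic) [νG.IsHaarMeasure] [νG.IsInvInvariant]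
    (μK : Measure ((standardMaximalCompactGL 3 L).comap (adelicVal (↥(maximalRealSubfield L)) L (IsCMField.complexConj L) 3 ((StdForm.antidiagonal 3).over L)) : Subgroup (quasiSplit (↥(maximalRealSubfield L)) L (IsCMField.complexConj L) 3).Adelic))
    [μK.IsHaarMeasure]
    (νI : Measure (AdeleRing (𝓞 L) L)ˣ) [νI.IsHaarMeasure]
    {𝓕I : Set (AdeleRing (𝓞 L) L)ˣ} (h𝓕I : IsIdeleClassDomain L 𝓕I)
    (ν : Measure ↥(adelicUnipotent (↥(maximalRealSubfield L)) L (IsCMField.complexConj L) 3)) [ν.IsHaarMeasure]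
    {𝓕 : Set ↥(adelicUnipotent (↥(maximalRealSubfield L)) L (IsCMField.complexConj L) 3)} (h𝓕N : IsFundamentalDomain ↥(rationalUnipotent (↥(maximalRealSubfield L)) L (IsCMField.complexConj L) 3) 𝓕 ν) (h𝓕1 : ν 𝓕 = 1)
    (h𝓕c : IsCompact (closure 𝓕))
    {β : (quasiSplit (↥(maximalRealSubfield L)) L (IsCMField.complexConj L) 3).Adelic → ℝ≥0∞} (hβ : IsCoveringWeight ((arithmeticBorel (↥(maximalRealSubfield L)) L (IsCMField.complexConj L) 3).map (quasiSplit (↥(maximalRealSubfield L)) L (IsCMField.complexConj L) 3).arithmeticSubgroup.subtype) β)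
    {φ₀ : ℂ}
    -- the (L3)₃ scalar: holomorphic on `{1 < Re} ∖ {2}` with the (normalised) tube formula
    {c : ℂ → ℂ} (hchol : DifferentiableOn ℂ c ({z : ℂ | 1 < z.re} \ {2})) (hceq : ∀ z : ℂ, 2 < z.re → c z = (∫ v : ↥(adelicUnipotent (↥(maximalRealSubfield L)) L (IsCMField.complexConj L) 3), (((borelHeight ((quasiSplit (↥(maximalRealSubfield L)) L (IsCMField.complexConj L) 3).toAdelic (weylLongU ((IsCMField.complexConj L : L ≃ₐ[↥(maximalRealSubfield L)] L) : L →+* L) (rfl : (StdForm.antidiagonal 3).over L = (StdForm.antidiagonal 3).over L)) * (v : (quasiSplit (↥(maximalRealSubfield L)) L (IsCMField.complexConj L) 3).Adelic))) : ℝ) : ℂ) ^ z ∂ν))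
    -- one ball of the road: holomorphy set `U`, pole set `P`, continued family `Ec`, the truncated `L²` family at one level
    {R : ℝ} (hR : 3 ≤ R) {U P : Set ℂ} (hUo : IsOpen U) (hUcd : ∀ z₀ ∈ Metric.ball (0 : ℂ) R, ∀ᶠ s in 𝓝[≠] z₀, s ∈ U)
    (hPc : IsClosed P) (hPcd : ∀ z₀ : ℂ, ∀ᶠ s in 𝓝[≠] z₀, s ∉ P)
    (Ec : ℂ → (quasiSplit (↥(maximalRealSubfield L)) L (IsCMField.complexConj L) 3).Adelic → ℂ) (hEcE : ∀ z : ℂ, 2 < z.re → Ec z = eisensteinSeriesU (flatSectionU (fun _ : (quasiSplit (↥(maximalRealSubfield L)) L (IsCMField.complexConj L) 3).Adelic => φ₀) z))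
    {T₀ : ℝ≥0} (hT₀ : 1 ≤ T₀) (Fam : ℂ → Lp ℂ 2 μ) (hFd : DifferentiableOn ℂ Fam (U \ P))
    (hFam : ∀ z ∈ U \ P, ((Fam z : Lp ℂ 2 μ) : (quasiSplit (↥(maximalRealSubfield L)) L (IsCMField.complexConj L) 3).automorphicQuotient → ℂ) =ᵐ[μ] (quasiSplit (↥(maximalRealSubfield L)) L (IsCMField.complexConj L) 3).quotFun (truncation ν 𝓕 T₀ (Ec z)))
    {r : ℂ} (hcres : Tendsto (fun z : ℂ => (z - 2) * c z) (𝓝[≠] 2) (𝓝 r)) :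
    ∃ C : ℝ, ∀ᶠ z in 𝓝[≠] (2 : ℂ), ‖(z - 2) • Fam z‖ ≤ C := by
  obtain ⟨cμ, K, cμ', K', hdiag, hdiag'⟩ := exists_diag_identities_of_road L μ νG μK νI h𝓕I ν h𝓕N h𝓕1 h𝓕c hβ hchol hceq hR hUo hUcd hPc hPcd Ec hEcE hT₀ Fam hFd hFam
  set κI : ℝ := (∫ x in {x : (AdeleRing (𝓞 L) L)ˣ | (IdeleClassGroup.ideleNorm L x : ℝ) ≤ 1} ∩ 𝓕I, (IdeleClassGroup.ideleNorm L x : ℝ) ∂νI) with hκI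
  set mK : ℝ := μK.real Set.univ with hmK
  have hT₀pos : (0 : ℝ) < ((T₀ : ℝ≥0) : ℝ) := lt_of_lt_of_le one_pos (by exact_mod_cast hT₀)
  have hreo : IsOpen {z : ℂ | 1 < z.re} := isOpen_lt continuous_const Complex.continuous_re
  have hVo : IsOpen ({z : ℂ | 1 < z.re} \ {2}) := hreo.sdiff isClosed_singleton
  have hcreal : ∀ x : ℝ, 1 < x → x ≠ 2 → (c (x : ℂ)).im = 0 := fun x hx hx2 => im_scalar_eq_zero L ν hchol hceq hx hx2
  have h2re : (1 : ℝ) < (2 : ℂ).re := by norm_num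
  -- `d = (z − 2)c̃` analytic at `2`
  have hVmem : ∀ᶠ z in 𝓝[≠] (2 : ℂ), z ∈ {z : ℂ | 1 < z.re} \ {2} := by
    filter_upwards [mem_nhdsWithin_of_mem_nhds (hreo.mem_nhds h2re), self_mem_nhdsWithin] with z hz hz2 using ⟨hz, hz2⟩
  obtain ⟨d, hd, hdc⟩ := exists_analyticAt_eventuallyEq_of_differentiableAt_of_eventually_norm_le (f := fun z : ℂ => (z - 2) * c z) (z₁ := (2 : ℂ))
    (hVmem.mono fun z hz => (differentiableAt_id.sub_const 2).mul (hchol.differentiableAt (hVo.mem_nhds hz))) ⟨‖r‖ + 1, (hcres.norm.eventually (Iic_mem_nhds (lt_add_one ‖r‖))).mono fun z hz => hz⟩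
  have hreal2 : ∀ᶠ x : ℝ in 𝓝[≠] (2 : ℝ), (c (x : ℂ)).im = 0 := by
    filter_upwards [mem_nhdsWithin_of_mem_nhds (lt_mem_nhds (show (1 : ℝ) < 2 by norm_num)), self_mem_nhdsWithin] with x hx hx2 using hcreal x hx hx2
  obtain ⟨C₁, hC₁⟩ := exists_normSq_mul_norm_fourTerm_diag_le_two cμ K κI mK hT₀pos φ₀ hd hdc hreal2
  -- the reflected scalars `c̃♯, d♯`
  have hconj : Tendsto (fun z : ℂ => conj z) (𝓝[≠] (2 : ℂ)) (𝓝[≠] (2 : ℂ)) :=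
    tendsto_nhdsWithin_of_tendsto_nhds_of_eventually_within _ ((Complex.continuous_conj.tendsto' 2 2 (Complex.conj_ofNat 2)).mono_left nhdsWithin_le_nhds) (by
      filter_upwards [self_mem_nhdsWithin] with z hz
      exact fun h => hz (by
        rw [Set.mem_singleton_iff] at h ⊢
        have h' := congrArg conj h
        rwa [Complex.conj_conj, Complex.conj_ofNat] at h'))
  obtain ⟨ρ, hρ, hdball⟩ := hd.exists_ball_analyticOnNhd
  have hBset : {w : ℂ | conj w ∈ Metric.ball (2 : ℂ) ρ} = Metric.ball (2 : ℂ) ρ := by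
    ext w
    simp only [Set.mem_setOf_eq, Metric.mem_ball, dist_eq_norm]
    rw [show conj w - 2 = conj (w - 2) by rw [map_sub, Complex.conj_ofNat], Complex.norm_conj]
  have hd' : AnalyticAt ℂ (fun u : ℂ => conj (d (conj u))) 2 := by
    have h := differentiableOn_conj_comp_conj Metric.isOpen_ball hdball.differentiableOn
    rw [hBset] at h
    exact h.analyticOnNhd Metric.isOpen_ball 2 (Metric.mem_ball_self hρ)
  have hdc' : ∀ᶠ u in 𝓝[≠] (2 : ℂ), (fun u : ℂ => conj (d (conj u))) u = (u - 2) * (fun u : ℂ => conj (c (conj u))) u := by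
    filter_upwards [hconj.eventually hdc] with u hu
    have hu' : d (conj u) = (conj u - 2) * c (conj u) := hu
    show conj (d (conj u)) = (u - 2) * conj (c (conj u))
    rw [hu', map_mul, map_sub, Complex.conj_conj, Complex.conj_ofNat]
  have hreal2' : ∀ᶠ x : ℝ in 𝓝[≠] (2 : ℝ), ((fun u : ℂ => conj (c (conj u))) (x : ℂ)).im = 0 := by
    filter_upwards [hreal2] with x hx
    simp only [Complex.conj_ofReal, Complex.conj_im, hx, neg_zero]
  obtain ⟨C₂, hC₂⟩ := exists_normSq_mul_norm_fourTerm_diag_le_two cμ' K' κI mK hT₀pos φ₀ (c := fun u : ℂ => conj (c (conj u))) (d := fun u : ℂ => conj (d (conj u)))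
    hd' hdc' hreal2'
  have hC₂' := hconj.eventually hC₂
  -- near `2` one is in `U ∖ P`, in the ball, right of `Re = 1`
  have h2b : (2 : ℂ) ∈ Metric.ball (0 : ℂ) R := by
    rw [mem_ball_zero_iff]
    have : ‖(2 : ℂ)‖ = 2 := by simp
    linarith
  have hmem : ∀ᶠ z in 𝓝[≠] (2 : ℂ), z ∈ U \ P := by filter_upwards [hUcd 2 h2b, hPcd 2] with z hU hP using ⟨hU, hP⟩
  have hnear : ∀ᶠ z in 𝓝[≠] (2 : ℂ), 1 < z.re ∧ z ∈ Metric.ball (0 : ℂ) R := mem_nhdsWithin_of_mem_nhds (Filter.inter_mem (hreo.mem_nhds h2re) (Metric.isOpen_ball.mem_nhds h2b))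
  have key : ∀ᶠ z in 𝓝[≠] (2 : ℂ), z.im ≠ 0 → ‖(z - 2) • Fam z‖ ≤ max (Real.sqrt C₁) (Real.sqrt C₂) := by
    filter_upwards [hmem, hnear, hC₁, hC₂'] with z hzUP hz1b hz₁ hz₂ hzim
    have hsq : ‖(z - 2) • Fam z‖ ^ 2 = ‖z - 2‖ ^ 2 * ‖(((‖Fam z‖ ^ 2 : ℝ)) : ℂ)‖ := by
      rw [norm_smul, mul_pow, Complex.norm_real, Real.norm_of_nonneg (sq_nonneg _)]
    have hroot : ∀ {C : ℝ}, ‖(z - 2) • Fam z‖ ^ 2 ≤ C → ‖(z - 2) • Fam z‖ ≤ Real.sqrt C := fun {C} h =>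
      (Real.sqrt_sq (norm_nonneg _)).symm.trans_le (Real.sqrt_le_sqrt h)
    rcases lt_or_gt_of_ne hzim with hneg | hpos
    · have h1 := hdiag' (conj z) (by rw [Complex.conj_conj]; exact hz1b.2) (by rw [Complex.conj_re]; exact hz1b.1)
        (by rw [Complex.conj_im]; linarith) (by rw [Complex.conj_conj]; exact hzUP.1) (by rw [Complex.conj_conj]; exact hzUP.2)
      have h2 : ‖conj z - 2‖ ^ 2 * ‖(((‖Fam (conj (conj z))‖ ^ 2 : ℝ)) : ℂ)‖ ≤ C₂ := by
        rw [h1]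
        exact hz₂ (by rw [Complex.conj_im]; exact neg_ne_zero.2 hzim)
      rw [Complex.conj_conj, show conj z - 2 = conj (z - 2) by rw [map_sub, Complex.conj_ofNat], Complex.norm_conj, ← hsq] at h2
      exact (hroot h2).trans (le_max_right _ _)
    · have h1 := hdiag z hz1b.2 hz1b.1 hpos hzUP.1 hzUP.2
      have h2 : ‖z - 2‖ ^ 2 * ‖(((‖Fam z‖ ^ 2 : ℝ)) : ℂ)‖ ≤ C₁ := by
        rw [h1]
        exact hz₁ hzim
      rw [← hsq] at h2
      exact (hroot h2).trans (le_max_left _ _)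
  exact ⟨_, eventually_norm_le_of_im_ne_zero (hUo.sdiff hPc) (((continuous_id.sub continuous_const).continuousOn).smul hFd.continuousOn) hmem key⟩

end Family

end Summit.HodgeConjecture.HodgeConjecture.Cruxes.H413.K2E1SphericalEisensteinL2BoundCMThree

end
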